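import Summits.QuantumFields.YangMills.Theorems.UnitScaleTiltHalvingP1FlatPillarRoomOfSuppliers
import HarnessLib

/-!
# Route `UnitScaleTilt`, crux K1 child «MinimiserStabilityRegPr» (stmt-QuantumFields-19200), registered stub `stub_halvingStep` (v10 `BirthV10`) —
# **PREFIX «ρ5», FILE (3): THE ADAPTER `hSupUρ5_of_hSupUρ4 : hSupUρ4 → hSupUρ5`** (★★OWNER «w3-20520: ρ5 GO» 01:51:09Z (c)): the ρ5 supplier currency
# `hSupUρ5` (hypothesis of ✓`HalvingP1FlatPillarRoomOfSuppliersRho5.hP1roomρ5_of_suppliers`) is WEAKER than the ρ4 currency `hSupUρ4` (hypothesis of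
# ✓`HalvingP1FlatPillarRoomOfSuppliersRho4.hP1roomρ4_of_suppliers`, inhabited by v7γ's ✓p686336 `hSupUρ4_of_socketsγ`): instantiate the three new per-`L`
# letters by `sx := 0, ρ₅ := 0, Cθ := 0` and DROP the three new member antecedents `Cθ·(ρ+M+L+S) ≤ Cr`, `L^(sx+1) ∣ ρ+M+L+S`, `ρ₅ ≤ ρ`.  So the ρ5 DOOR flips
# early with the v7γ display UNCHANGED:  `BirthV10.stub_halvingStep` ⟸ ✓`stub_halvingStep_of_hP1roomρ5` ∘ ✓`hP1roomρ5_of_suppliers` ∘ THIS ∘ ✓p686336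
# (E2E scratch of the four-fold composition rc 0, HOME `ym-ust-20520-w3/g8/SCRATCH-E2E-rho5-flip.rc0.w3g8.lean`); the NATIVE ρ5 socket edition (packs ρ5 ∕ member
# rows ρ5 ∕ K-final ρ5, successor LEAD-H g7 WORD 3 texts (T1)–(T5)) replaces THIS adapter when it lands.

Cell `ym3-torus` (HUMAN RULING D-0037, YM ladder rung R3 — YM₃ on T³ is a RUNG, NOT the Clay problem), width seat `ym-ust-20520-w3` gen 8.
`--supports stmt-QuantumFields-19200 --as helper`; count-neutral; def-free, 0 sorry, standard axioms; both texts are HYPOTHESIS currencies — nothing here claims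
`hSupUρ4`, the stub, the crux, the rung or the mass gap.  HONEST SCOPE: ten lines of quantifier bookkeeping.

References: T. Bałaban, CMP **99** (1985) 75–102 [Balaban1985RegularSpaces] Thm 2 p.83, p.98; CMP **102** (1985) 277–309 [Balaban1985Variational] (150)–(156) pp.301–302.
-/

set_option autoImplicit false

noncomputable section

open scoped BigOperators Matrix.Norms.L2Operator

namespace Summit.QuantumFields.YangMills.Theorems.HalvingHSupURho5OfRho4

open Literature.MathematicalPhysics.QuantumFieldTheory.Balaban1983to89
open Literature.MathematicalPhysics.QuantumFieldTheory.Balaban1983to89.T3ContinuumYM3Torus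
open Literature.MathematicalPhysics.QuantumFieldTheory.Balaban1983to89.T3PrintedRegularMinimiser
open T4Continuum BlockAveraging ExpMeanLog T3RegularMinimiser
open Complex (I)
open MatrixLog (mlog)
open B5Eq118OneStroke (iterBlockOf)
open B6SectAOperatorsV1 (SiteIdx)
open B7Prop1Explicit renaming Site → LSite
open B7Prop1Explicit (e)
open B7Prop1Local (InBox)
open B8Eq131Cubes (cube flm gs sqLo sqHi)
open B8Eq138LandauZd (covDivB covLap QT)
open B8CubeMemberZd (cubeLamS)
open B10Eq27TorusAxialLog (transl rel unitsField toUField suIncl gaugeActT axialT)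
open B15Eq112TorusCover (lift)
open Node00 (coverAt)
open LatticeFieldCalculus (laplace diverg siteAvgIter)
open FlatCubeOpsText (IsLevWeight)
open FlatCubeSequenceAligned (cubeSeqMT3 cubeSetM)
open Summit.QuantumFields.YangMills.Theorems.Prop8ChartDoubleBar (dbarIterU vframeU)
open HalvingP1FlatPillar (DP1Clause)
open HalvingP1FlatPillarPrime (P1FlatPillarAt')
open HalvingP1FlatCoreExtractionMult (p1FlatPillar'_room_of_mlogChartDataMult)
open HalvingP1FlatCoreChartDataDoor (mlogChartDataMult_of_suppliers_cubeLamS)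
open P1FlatCoreCubeInclusion (corner_of_offset room_of_level_k)
open P1FlatCoreDP1Target (sitesPerDir_top_eq)
open HalvingP1FlatCoreFamilyDoor (p1FlatPillar'_room_of_suppliers)
open HalvingP1FlatPillarRoomOfSuppliers (cubeData_of_prefix window_mono_B₁ ha7_of_window)

open Classical in
/-- ★★ **ρ5 ADAPTER**: the ρ4 supplier text implies the ρ5 supplier text (`sx := 0, ρ₅ := 0, Cθ := 0`; the three extra member antecedents are discarded).
[cite: Balaban1985RegularSpaces, Thm 2 p.83, p.98; Balaban1985Variational, (150)-(156) pp.301-302] -/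
theorem hSupUρ5_of_hSupUρ4
    (hSupUρ4 : ∀ L : ℕ, Odd L → 1 < L → ∃ (Mₚ Rₚ : ℕ), ∀ (R M aₑ S : ℕ) (hM : 1 ≤ M), M = L ^ aₑ → Mₚ ≤ M → Rₚ ≤ R → R * M ≤ S →
      ∃ B₁ : ℝ, 0 ≤ B₁ ∧ ∃ M' : ℕ, 1 ≤ M' ∧ ∃ Cρ : ℝ, 0 < Cρ ∧ ∃ qρ : ℕ,
      ∀ (ρ : ℕ) (a Cr : ℝ), 0 < Cr → 4 < Cr → 12 * ((ρ : ℝ) + (M : ℝ)) * a ≤ Cr →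
        16 * 3800 * ((5 * L : ℕ) : ℝ) ^ 2 * (L : ℝ) * ((B₁ * ((ρ : ℝ) + 1) ^ qρ + 1) * a) ≤ 1 → Cρ * ((ρ : ℝ) + 1) ^ qρ * a ≤ 1 →
        ∀ F : T3Family, F.L = L → ∀ (n K : ℕ) (hnK : n < K), 2 * ρ + (M' + 1 + 2 * (M + L + S)) ≤ F.L ^ (F.m + n) →
          ∀ (ε₀ ε₁ : ℝ), 0 < ε₁ → 0 < ε₀ → ε₀ ≤ a → Cr * ε₁ ≤ ε₀ →
          ∀ V : GaugeField (F.P n) 0 (Matrix.specialUnitaryGroup (Fin 2) ℂ), PlaqSmall ε₁ V →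
            ∀ U ∈ regFibrePr F n K hnK.le ε₀ V, ∀ x₀ : Site (F.P K) 0,
              ∃ (t : ℤ) (_ : 0 ≤ t) (_ : t ≤ (M' : ℤ) - 1)
                (w : LSite (F.P K).d → Matrix.specialUnitaryGroup (Fin 2) ℂ) (X : LSite (F.P K).d → Fin (F.P K).d → Matrix (Fin 2) (Fin 2) ℂ)
                (μ : ℕ → LSite (F.P K).d → Matrix (Fin 2) (Fin 2) ℂ)
                (g h' : GaugeTransf (F.P K) 0 (Matrix (Fin 2) (Fin 2) ℂ)ˣ) (κ' : (i : ℕ) → GaugeTransf (F.P K) i (Matrix (Fin 2) (Fin 2) ℂ)ˣ)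
                (ν : (i : ℕ) → Site (F.P K) i → (Matrix (Fin 2) (Fin 2) ℂ)ˣ) (gs' : (i : ℕ) → GaugeTransf (F.P K) i (Matrix (Fin 2) (Fin 2) ℂ)ˣ),
                -- [N05 ∕ J3] chart rows and flat Landau window at the corner `a := Bᵏx₀ − t`
                (∀ z ∈ cube (F.P K).L (fun μ => ((iterBlockOf (K - n) x₀ μ).val : ℤ) - t) M' (ρ + M + L + S) (K - n) 0, ∀ ν : Fin (F.P K).d,
                  transl (0 : Site (F.P K) 0) z ∈ cubeSetM x₀ (K - n) ρ S M 0 → (transl (0 : Site (F.P K) 0) z).shift ν ∈ cubeSetM x₀ (K - n) ρ S M 0 →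
                  ‖(((Unitary.toUnits (suIncl (w z)))⁻¹ * unitsField (toUField U) ⟨transl 0 z, ν⟩ * Unitary.toUnits (suIncl (w (z + e ν))) :
                      (Matrix (Fin 2) (Fin 2) ℂ)ˣ) : Matrix (Fin 2) (Fin 2) ℂ) - 1‖ ≤ 1 / 4) ∧
                (∀ z ∈ cube (F.P K).L (fun μ => ((iterBlockOf (K - n) x₀ μ).val : ℤ) - t) M' (ρ + M + L + S) (K - n) 0, ∀ ν : Fin (F.P K).d,
                  transl (0 : Site (F.P K) 0) z ∈ cubeSetM x₀ (K - n) ρ S M 0 → (transl (0 : Site (F.P K) 0) z).shift ν ∈ cubeSetM x₀ (K - n) ρ S M 0 →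
                  I • ((((F.L : ℝ)⁻¹) ^ (K - n)) • X z ν) = mlog (((Unitary.toUnits (suIncl (w z)))⁻¹ * unitsField (toUField U) ⟨transl 0 z, ν⟩ *
                      Unitary.toUnits (suIncl (w (z + e ν))) : (Matrix (Fin 2) (Fin 2) ℂ)ˣ) : Matrix (Fin 2) (Fin 2) ℂ)) ∧
                (∀ z ∈ cube (F.P K).L (fun μ => ((iterBlockOf (K - n) x₀ μ).val : ℤ) - t) M' (ρ + M + L + S) (K - n) 0,
                  covLap (((F.L : ℝ)⁻¹) ^ (K - n)) (1 : LSite (F.P K).d → Fin (F.P K).d → (Matrix (Fin 2) (Fin 2) ℂ)ˣ)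
                      ((cube (F.P K).L (fun μ => ((iterBlockOf (K - n) x₀ μ).val : ℤ) - t) M' (ρ + M + L + S) (K - n) 0).indicator
                        (covDivB (((F.L : ℝ)⁻¹) ^ (K - n)) (1 : LSite (F.P K).d → Fin (F.P K).d → (Matrix (Fin 2) (Fin 2) ℂ)ˣ) X)) z =
                    QT (F.P K).L (K - n) (cubeLamS (F.P K).L (fun μ => ((iterBlockOf (K - n) x₀ μ).val : ℤ) - t) M' (ρ + M + L + S) (K - n) (K - n))
                      (1 : LSite (F.P K).d → Fin (F.P K).d → (Matrix (Fin 2) (Fin 2) ℂ)ˣ) μ z) ∧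
                -- [top step] frames, composite gauge, top identity
                κ' 0 = h' ∧
                (∀ (i : ℕ) (y : Site (F.P K) (i + 1)),
                  κ' (i + 1) y = (vframeU (gaugeActT (κ' i) (dbarIterU i (gaugeActT g (unitsField (toUField U))))) y)⁻¹ * κ' i (emb y) *
                    vframeU (dbarIterU i (gaugeActT g (unitsField (toUField U)))) y) ∧
                (∀ s, ν 0 s = 1) ∧
                (∀ (i : ℕ) (y : Site (F.P K) (i + 1)), ν (i + 1) y = ν i (emb y) * vframeU (dbarIterU i (gaugeActT g (unitsField (toUField U)))) y) ∧
                gs' 0 = g ∧ (∀ (i : ℕ) (y : Site (F.P K) (i + 1)), gs' (i + 1) y = gs' i (emb y)) ∧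
                (∀ s, (Unitary.toUnits (suIncl (w (lift (F.P K) x₀ + rel x₀ s))))⁻¹ =
                  ((gs' (K - n) (iterBlockOf (K - n) x₀))⁻¹ * ν (K - n) (iterBlockOf (K - n) x₀)) * h' s * g s) ∧
                (∀ yc ∈ cubeLamS (F.P K).L (fun μ => ((iterBlockOf (K - n) x₀ μ).val : ℤ) - t) M' (ρ + M + L + S) (K - n) (K - n) (K - n),
                  κ' (K - n) (coverAt (F.P K) (K - n) yc) =
                    axialT (dbarIterU (K - n) (gaugeActT g (unitsField (toUField U)))) (iterBlockOf (K - n) x₀) (coverAt (F.P K) (K - n) yc)) ∧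
                -- [sizes] the two (1.36)♭ rows of `A := X ∘ rep`
                (∀ wt : ℕ → PBond (F.P K) 0 → ℝ, IsLevWeight F n K (cubeSeqMT3 F n K x₀ ρ S M hM) wt →
                  (∀ b : PBond (F.P K) 0, wt 1 b *
                    ‖(fun b : PBond (F.P K) 0 => if b.src ∈ cubeSetM x₀ (K - n) ρ S M 0 ∧ b.tgt ∈ cubeSetM x₀ (K - n) ρ S M 0 then
                      X (lift (F.P K) x₀ + rel x₀ b.src) b.dir else 0) b‖ ≤ B₁ * ((ρ : ℝ) + 1) ^ qρ * ε₀) ∧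
                  (∀ (b : PBond (F.P K) 0) (ν' : Fin (F.P K).d), wt 2 b * (F.L : ℝ) ^ (K - n) *
                    ‖(fun b : PBond (F.P K) 0 => if b.src ∈ cubeSetM x₀ (K - n) ρ S M 0 ∧ b.tgt ∈ cubeSetM x₀ (K - n) ρ S M 0 then
                        X (lift (F.P K) x₀ + rel x₀ b.src) b.dir else 0) ⟨b.src.shift ν', b.dir⟩ -
                      (fun b : PBond (F.P K) 0 => if b.src ∈ cubeSetM x₀ (K - n) ρ S M 0 ∧ b.tgt ∈ cubeSetM x₀ (K - n) ρ S M 0 then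
                        X (lift (F.P K) x₀ + rel x₀ b.src) b.dir else 0) b‖ ≤ B₁ * ((ρ : ℝ) + 1) ^ qρ * ε₀))) :
    ∀ L : ℕ, Odd L → 1 < L → ∃ (Mₚ Rₚ sx ρ₅ : ℕ) (Cθ : ℝ), ∀ (R M aₑ S : ℕ) (hM : 1 ≤ M), M = L ^ aₑ → Mₚ ≤ M → Rₚ ≤ R → R * M ≤ S →
      ∃ B₁ : ℝ, 0 ≤ B₁ ∧ ∃ M' : ℕ, 1 ≤ M' ∧ ∃ Cρ : ℝ, 0 < Cρ ∧ ∃ qρ : ℕ,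
      ∀ (ρ : ℕ) (a Cr : ℝ), 0 < Cr → 4 < Cr → 12 * ((ρ : ℝ) + (M : ℝ)) * a ≤ Cr → Cθ * ((ρ + M + L + S : ℕ) : ℝ) ≤ Cr → L ^ (sx + 1) ∣ ρ + M + L + S → ρ₅ ≤ ρ →
        16 * 3800 * ((5 * L : ℕ) : ℝ) ^ 2 * (L : ℝ) * ((B₁ * ((ρ : ℝ) + 1) ^ qρ + 1) * a) ≤ 1 → Cρ * ((ρ : ℝ) + 1) ^ qρ * a ≤ 1 →
        ∀ F : T3Family, F.L = L → ∀ (n K : ℕ) (hnK : n < K), 2 * ρ + (M' + 1 + 2 * (M + L + S)) ≤ F.L ^ (F.m + n) →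
          ∀ (ε₀ ε₁ : ℝ), 0 < ε₁ → 0 < ε₀ → ε₀ ≤ a → Cr * ε₁ ≤ ε₀ →
          ∀ V : GaugeField (F.P n) 0 (Matrix.specialUnitaryGroup (Fin 2) ℂ), PlaqSmall ε₁ V →
            ∀ U ∈ regFibrePr F n K hnK.le ε₀ V, ∀ x₀ : Site (F.P K) 0,
              ∃ (t : ℤ) (_ : 0 ≤ t) (_ : t ≤ (M' : ℤ) - 1)
                (w : LSite (F.P K).d → Matrix.specialUnitaryGroup (Fin 2) ℂ) (X : LSite (F.P K).d → Fin (F.P K).d → Matrix (Fin 2) (Fin 2) ℂ)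
                (μ : ℕ → LSite (F.P K).d → Matrix (Fin 2) (Fin 2) ℂ)
                (g h' : GaugeTransf (F.P K) 0 (Matrix (Fin 2) (Fin 2) ℂ)ˣ) (κ' : (i : ℕ) → GaugeTransf (F.P K) i (Matrix (Fin 2) (Fin 2) ℂ)ˣ)
                (ν : (i : ℕ) → Site (F.P K) i → (Matrix (Fin 2) (Fin 2) ℂ)ˣ) (gs' : (i : ℕ) → GaugeTransf (F.P K) i (Matrix (Fin 2) (Fin 2) ℂ)ˣ),
                -- [N05 ∕ J3] chart rows and flat Landau window at the corner `a := Bᵏx₀ − t`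
                (∀ z ∈ cube (F.P K).L (fun μ => ((iterBlockOf (K - n) x₀ μ).val : ℤ) - t) M' (ρ + M + L + S) (K - n) 0, ∀ ν : Fin (F.P K).d,
                  transl (0 : Site (F.P K) 0) z ∈ cubeSetM x₀ (K - n) ρ S M 0 → (transl (0 : Site (F.P K) 0) z).shift ν ∈ cubeSetM x₀ (K - n) ρ S M 0 →
                  ‖(((Unitary.toUnits (suIncl (w z)))⁻¹ * unitsField (toUField U) ⟨transl 0 z, ν⟩ * Unitary.toUnits (suIncl (w (z + e ν))) :
                      (Matrix (Fin 2) (Fin 2) ℂ)ˣ) : Matrix (Fin 2) (Fin 2) ℂ) - 1‖ ≤ 1 / 4) ∧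
                (∀ z ∈ cube (F.P K).L (fun μ => ((iterBlockOf (K - n) x₀ μ).val : ℤ) - t) M' (ρ + M + L + S) (K - n) 0, ∀ ν : Fin (F.P K).d,
                  transl (0 : Site (F.P K) 0) z ∈ cubeSetM x₀ (K - n) ρ S M 0 → (transl (0 : Site (F.P K) 0) z).shift ν ∈ cubeSetM x₀ (K - n) ρ S M 0 →
                  I • ((((F.L : ℝ)⁻¹) ^ (K - n)) • X z ν) = mlog (((Unitary.toUnits (suIncl (w z)))⁻¹ * unitsField (toUField U) ⟨transl 0 z, ν⟩ *
                      Unitary.toUnits (suIncl (w (z + e ν))) : (Matrix (Fin 2) (Fin 2) ℂ)ˣ) : Matrix (Fin 2) (Fin 2) ℂ)) ∧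
                (∀ z ∈ cube (F.P K).L (fun μ => ((iterBlockOf (K - n) x₀ μ).val : ℤ) - t) M' (ρ + M + L + S) (K - n) 0,
                  covLap (((F.L : ℝ)⁻¹) ^ (K - n)) (1 : LSite (F.P K).d → Fin (F.P K).d → (Matrix (Fin 2) (Fin 2) ℂ)ˣ)
                      ((cube (F.P K).L (fun μ => ((iterBlockOf (K - n) x₀ μ).val : ℤ) - t) M' (ρ + M + L + S) (K - n) 0).indicator
                        (covDivB (((F.L : ℝ)⁻¹) ^ (K - n)) (1 : LSite (F.P K).d → Fin (F.P K).d → (Matrix (Fin 2) (Fin 2) ℂ)ˣ) X)) z =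
                    QT (F.P K).L (K - n) (cubeLamS (F.P K).L (fun μ => ((iterBlockOf (K - n) x₀ μ).val : ℤ) - t) M' (ρ + M + L + S) (K - n) (K - n))
                      (1 : LSite (F.P K).d → Fin (F.P K).d → (Matrix (Fin 2) (Fin 2) ℂ)ˣ) μ z) ∧
                -- [top step] frames, composite gauge, top identity
                κ' 0 = h' ∧
                (∀ (i : ℕ) (y : Site (F.P K) (i + 1)),
                  κ' (i + 1) y = (vframeU (gaugeActT (κ' i) (dbarIterU i (gaugeActT g (unitsField (toUField U))))) y)⁻¹ * κ' i (emb y) *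
                    vframeU (dbarIterU i (gaugeActT g (unitsField (toUField U)))) y) ∧
                (∀ s, ν 0 s = 1) ∧
                (∀ (i : ℕ) (y : Site (F.P K) (i + 1)), ν (i + 1) y = ν i (emb y) * vframeU (dbarIterU i (gaugeActT g (unitsField (toUField U)))) y) ∧
                gs' 0 = g ∧ (∀ (i : ℕ) (y : Site (F.P K) (i + 1)), gs' (i + 1) y = gs' i (emb y)) ∧
                (∀ s, (Unitary.toUnits (suIncl (w (lift (F.P K) x₀ + rel x₀ s))))⁻¹ =
                  ((gs' (K - n) (iterBlockOf (K - n) x₀))⁻¹ * ν (K - n) (iterBlockOf (K - n) x₀)) * h' s * g s) ∧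
                (∀ yc ∈ cubeLamS (F.P K).L (fun μ => ((iterBlockOf (K - n) x₀ μ).val : ℤ) - t) M' (ρ + M + L + S) (K - n) (K - n) (K - n),
                  κ' (K - n) (coverAt (F.P K) (K - n) yc) =
                    axialT (dbarIterU (K - n) (gaugeActT g (unitsField (toUField U)))) (iterBlockOf (K - n) x₀) (coverAt (F.P K) (K - n) yc)) ∧
                -- [sizes] the two (1.36)♭ rows of `A := X ∘ rep`
                (∀ wt : ℕ → PBond (F.P K) 0 → ℝ, IsLevWeight F n K (cubeSeqMT3 F n K x₀ ρ S M hM) wt →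
                  (∀ b : PBond (F.P K) 0, wt 1 b *
                    ‖(fun b : PBond (F.P K) 0 => if b.src ∈ cubeSetM x₀ (K - n) ρ S M 0 ∧ b.tgt ∈ cubeSetM x₀ (K - n) ρ S M 0 then
                      X (lift (F.P K) x₀ + rel x₀ b.src) b.dir else 0) b‖ ≤ B₁ * ((ρ : ℝ) + 1) ^ qρ * ε₀) ∧
                  (∀ (b : PBond (F.P K) 0) (ν' : Fin (F.P K).d), wt 2 b * (F.L : ℝ) ^ (K - n) *
                    ‖(fun b : PBond (F.P K) 0 => if b.src ∈ cubeSetM x₀ (K - n) ρ S M 0 ∧ b.tgt ∈ cubeSetM x₀ (K - n) ρ S M 0 then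
                        X (lift (F.P K) x₀ + rel x₀ b.src) b.dir else 0) ⟨b.src.shift ν', b.dir⟩ -
                      (fun b : PBond (F.P K) 0 => if b.src ∈ cubeSetM x₀ (K - n) ρ S M 0 ∧ b.tgt ∈ cubeSetM x₀ (K - n) ρ S M 0 then
                        X (lift (F.P K) x₀ + rel x₀ b.src) b.dir else 0) b‖ ≤ B₁ * ((ρ : ℝ) + 1) ^ qρ * ε₀)) := by
  intro L hodd hL
  obtain ⟨Mₚ, Rₚ, h⟩ := hSupUρ4 L hodd hL
  refine ⟨Mₚ, Rₚ, 0, 0, 0, fun R M aₑ S hM hMe hMₚ hRₚ hRS => ?_⟩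
  obtain ⟨B₁, hB₁, M', hM', Cρ, hCρ, qρ, hb⟩ := h R M aₑ S hM hMe hMₚ hRₚ hRS
  exact ⟨B₁, hB₁, M', hM', Cρ, hCρ, qρ, fun ρ a Cr hCr hCr4 hreg₁ _ _ _ => hb ρ a Cr hCr hCr4 hreg₁⟩

end Summit.QuantumFields.YangMills.Theorems.HalvingHSupURho5OfRho4

end
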